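import Mathlib
import Summits.PneNP.PneNP.Theorems.SymmetryBudgetWindowBarrierMaterialiseLayout
import Summits.PneNP.PneNP.Theorems.SymmetryBudgetWindowBarrierMaterialiseSymm

/-!
# Materialisation of monadic guesses — evaluation of the layout and the theorem
(crux `SymmetryBudget.WindowBarrier`, item stmt-PneNP-2145; registered stub `stub_monadicGuess`;
part 3 of `SymmetryBudgetWindowBarrierMaterialiseLayout.lean` / `…MaterialiseSymm.lean`, whose
module docstrings state the materialisation lemma and prove layout and symmetry)

* `Materialise.eval_layout` — the layout (two wireless prefix gates `pre`, one relocated copy of the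
  template `C` per block `i < N` with the point inputs hard-wired along `φ i`, a final gate `op` over
  the `N` block outputs and `A` constant wires) evaluates to `op` applied to the block outputs
  `C.eval (w ↦ wireOf x (vals pre x) (φ i w))` (and the constants).  Proof by uniqueness of
  transcripts (`eq_transcript_of_gate_equations`): the candidate value list "prefix values, then
  block by block the transcript of `C` on the block's assignment, then the final value" satisfies
  every gate equation (`layout_getElem_pre/block/final`, `getD_transcript_eq_gateValue` for `C`).
* `stub_monadicGuess` — **one monadic guess over `Fin g` costs a factor `2^g`** for
  `Sym(Fin g)`-symmetric `tcBasis`-circuits on matrix inputs: from a `tcBasis`-circuit `C` on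
  `(Fin g × Fin g) ⊕ Fin g` admitting for every `σ` an automorphism over `(σ × σ) ⊕ σ`, the layout
  with `N = 2^g` blocks (one per subset `S`, enumerated by `Fin (2^g) ≃ Finset (Fin g)`), the
  constant prefix `[∧₀, ∨₀]` (`HeaderHardwiring.exists_constPre`) and the final gate `∨_N` is a
  square-symmetric `tcBasis`-circuit with `2^g · |C| + 3` gates computing `x ↦ [∃ S, C(x, 1_S)]`
  (symmetry: `Materialise.layout_isInducedAut` with the block permutation `S ↦ σ(S)`).
No definitions.
-/

-- `Summit.PneNP.PneNP.…` duplicates `PneNP` BY DESIGN (single-problem summit).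
set_option linter.dupNamespace false

namespace Summit.PneNP.PneNP.Theorems

open Literature.Computability.Complexity Literature.Computability.Complexity.GateList
open scoped Classical

namespace Materialise

section Eval

variable {ι : Type*} {g N A : ℕ} {C : Circuit (ι ⊕ Fin g)} {pre : List (Gate ι)}
  {φ : Fin N → (ι ⊕ Fin g) → ι ⊕ ℕ} {D : Circuit ι}
  {op : (Fin (N + A) → Bool) → Bool} {κ : ℕ → ℕ}

/-- A gate of arity `0` takes the same value over any two value lists. -/
theorem gateValue_eq_of_arity_zero (x : ι → Bool) (V W : List Bool) (q : Gate ι)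
    (hq : q.arity = 0) : gateValue x V q = gateValue x W q :=
  congrArg q.op (funext fun a => absurd (a.2.trans_eq hq) (Nat.not_lt_zero _))

/-- `GateList.vals` of a bare gate list is its transcript. -/
theorem vals_eq_transcript_list (l : List (Gate ι)) (x : ι → Bool) :
    vals l x = transcript x [] l := by
  suffices key : ∀ acc : List Bool,
      l.foldl (fun vs q => vs ++ [q.op fun a => wireOf x vs (q.args a)]) acc = transcript x acc l from
    key []
  induction l with
  | nil => intro acc; rfl
  | cons q l ih =>
    intro acc
    have e : (q.op fun a => wireOf x acc (q.args a)) = gateValue x acc q :=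
      congrArg q.op (funext fun a => (wireVal_eq_wireOf x acc (q.args a)).symm)
    rw [List.foldl_cons, transcript_cons, e]
    exact ih _

/-- The values of a two-gate wireless prefix: entry `j < 2` is the value of gate `j` over ANY value
list. -/
theorem getD_vals_pre (hpreL : pre.length = 2) (hpre0 : ∀ q ∈ pre, q.arity = 0) (hpreWF : WF pre)
    (x : ι → Bool) (W : List Bool) {j : ℕ} (hj : j < 2) :
    (vals pre x).getD j false = gateValue x W (pre[j]'(by omega)) := by
  set P₀ : Circuit ι := toCircuit pre (Sum.inr 0) hpreWF (fun m hm => by cases hm; omega) with hP₀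
  have h1 := getD_transcript_eq_gateValue P₀ x j (by change j < pre.length; omega)
  change (transcript x [] pre).getD j false = gateValue x (transcript x [] pre) (pre[j]'_) at h1
  rw [vals_eq_transcript_list, h1]
  exact gateValue_eq_of_arity_zero x _ _ _ (hpre0 _ (List.getElem_mem _))

/-- **Evaluation of the materialisation layout.** With prefix values `vals pre x`, block `k`
of the layout computes `C` on the assignment `w ↦ wireOf x (vals pre x) (φ k w)` (matrix input
`p ↦ x p`, point input `u ↦` the constant the wiring selects), and the final gate applies `op` to
the `N` block outputs followed by the `A` constants `κ`. -/
theorem eval_layout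
    (hDg : D.gates = pre ++
      (List.ofFn fun v : Fin (N * C.gates.length) =>
        reloc (φ ⟨v / C.gates.length, div_lt_of_lt_mul v.2⟩) (2 + (v / C.gates.length) * C.gates.length)
          (C.gates[(v : ℕ) % C.gates.length]'(mod_lt_of_lt_mul v.2))) ++
      [⟨N + A, op, fun k => if h : (k : ℕ) < N then
          shiftWire (φ ⟨k, h⟩) (2 + (k : ℕ) * C.gates.length) C.output
        else Sum.inr (κ (k - N))⟩])
    (hDo : D.output = Sum.inr (2 + N * C.gates.length)) (hpreL : pre.length = 2)
    (hpre0 : ∀ q ∈ pre, q.arity = 0) (hpreWF : WF pre) (hφ : ∀ i, WiresOK 2 (φ i))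
    (hκ : ∀ i, κ i < 2) (x : ι → Bool) :
    D.eval x = op (fun k => if h : (k : ℕ) < N then
        C.eval (fun w => wireOf x (vals pre x) (φ ⟨k, h⟩ w))
      else (vals pre x).getD (κ (k - N)) false) := by
  set c := C.gates.length with hc
  -- block assignments and block transcripts
  set X : Fin N → (ι ⊕ Fin g → Bool) := fun i w => wireOf x (vals pre x) (φ i w) with hX
  set T : Fin N → List Bool := fun i => transcript (X i) [] C.gates with hT
  have hTlen : ∀ i, (T i).length = c := fun i => by
    simp only [hT, length_transcript, List.length_nil, Nat.zero_add, hc]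
  -- the candidate transcript
  set fin : Bool := op (fun k => if h : (k : ℕ) < N then wireVal (X ⟨k, h⟩) (T ⟨k, h⟩) C.output
      else (vals pre x).getD (κ (k - N)) false) with hfin
  set W : List Bool := vals pre x ++
      ((List.ofFn fun v : Fin (N * c) => (T ⟨v / c, div_lt_of_lt_mul v.2⟩).getD ((v : ℕ) % c) false) ++
        [fin]) with hW
  have hpreVlen : (vals pre x).length = 2 := by rw [length_vals, hpreL]
  have hWlen : W.length = 2 + N * c + 1 := by
    rw [hW, List.length_append, List.length_append, List.length_ofFn, List.length_singleton, hpreVlen]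
    omega
  have hDlen : D.gates.length = 2 + N * c + 1 := layout_length hDg hpreL
  ---------------------------------------------------------------- indexing into `W`
  have hW0 : ∀ m, m < 2 → W.getD m false = (vals pre x).getD m false := by
    intro m hm
    rw [hW, List.getD_eq_getElem?_getD, List.getD_eq_getElem?_getD,
      List.getElem?_append_left (by omega)]
  have hWb : ∀ (i : Fin N) (m : ℕ), m < c → W.getD (2 + (i : ℕ) * c + m) false = (T i).getD m false := by
    intro i m hm
    have hv : (i : ℕ) * c + m < N * c := blockIndex_lt hm i.2
    rw [hW, List.getD_eq_getElem?_getD, List.getElem?_append_right (by omega), hpreVlen,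
      List.getElem?_append_left (by rw [List.length_ofFn]; omega), List.getElem?_ofFn]
    rw [dif_pos (by omega)]
    simp only [Option.getD_some]
    have hdm := div_mod_block (k := (i : ℕ)) hm
    have e1 : 2 + (i : ℕ) * c + m - 2 = (i : ℕ) * c + m := by omega
    have key : ∀ (v : ℕ) (hv : v / c < N), v = (i : ℕ) * c + m →
        (T ⟨v / c, hv⟩).getD (v % c) false = (T i).getD m false := by
      rintro v hv rfl
      have : (⟨((i : ℕ) * c + m) / c, hv⟩ : Fin N) = i := Fin.ext hdm.1
      rw [this, hdm.2]
    exact key _ _ e1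
  have hWf : W.getD (2 + N * c) false = fin := by
    rw [hW, List.getD_eq_getElem?_getD, List.getElem?_append_right (by omega), hpreVlen,
      List.getElem?_append_right (by rw [List.length_ofFn]; omega), List.length_ofFn]
    simp
  ---------------------------------------------------------------- wires into `W`
  have hwire_in : ∀ (i : Fin N) (w : ι ⊕ Fin g), wireVal x W (φ i w) = X i w := by
    intro i w
    simp only [hX]
    cases hw : φ i w with
    | inl p => rfl
    | inr m =>
      have hm : m < 2 := hφ i w m hw
      rw [wireVal, wireOf_inr, hW0 m hm]
  have hwire_shift : ∀ (i : Fin N) (w : (ι ⊕ Fin g) ⊕ ℕ), (∀ m, w = Sum.inr m → m < c) →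
      wireVal x W (shiftWire (φ i) (2 + (i : ℕ) * c) w) = wireVal (X i) (T i) w := by
    intro i w hw
    cases w with
    | inl w' => exact hwire_in i w'
    | inr m =>
      have hm : m < c := hw m rfl
      simp only [shiftWire, wireVal]
      rw [show m + (2 + (i : ℕ) * c) = 2 + (i : ℕ) * c + m by omega, hWb i m hm]
  ---------------------------------------------------------------- the gate equations
  have hgate : ∀ (j : ℕ) (hj : j < D.gates.length), W.getD j false = gateValue x W (D.gates[j]) := by
    intro j hj
    rw [hDlen] at hj
    rcases Nat.lt_or_ge j 2 with hj2 | hj2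
    · -- prefix
      rw [layout_getElem_pre hDg hpreL hj2, hW0 j hj2]
      exact getD_vals_pre hpreL hpre0 hpreWF x W hj2
    rcases Nat.lt_or_ge j (2 + N * c) with hjb | hjb
    · -- block `i`, position `m`
      obtain ⟨i, m, hm, rfl⟩ : ∃ (i : Fin N) (m : ℕ), m < c ∧ j = 2 + (i : ℕ) * c + m := by
        have hcpos : 0 < c := Nat.pos_of_ne_zero fun h0 => by rw [h0, Nat.mul_zero] at hjb; omega
        refine ⟨⟨(j - 2) / c, div_lt_of_lt_mul (by omega)⟩, (j - 2) % c, Nat.mod_lt _ hcpos, ?_⟩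
        have := Nat.div_add_mod' (j - 2) c
        simp only
        omega
      rw [hWb i m hm, layout_getElem_block hDg hpreL i ⟨m, hm⟩]
      rw [hT, getD_transcript_eq_gateValue C (X i) m hm]
      simp only [gateValue, reloc]
      refine congrArg (C.gates[m]).op (funext fun a => ?_)
      exact (hwire_shift i _ fun m' hm' => (C.wf m hm a m' hm').trans hm).symm
    · -- the final gate
      have hjf : j = 2 + N * c := by omega
      subst hjf
      rw [hWf, layout_getElem_final hDg hpreL]
      simp only [gateValue, hfin]
      refine congrArg op (funext fun k => ?_)
      by_cases hk : (k : ℕ) < N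
      · rw [dif_pos hk, dif_pos hk]
        exact (hwire_shift ⟨k, hk⟩ C.output fun m hm => C.wf_output m hm).symm
      · rw [dif_neg hk, dif_neg hk, wireVal, hW0 _ (hκ _)]
  ---------------------------------------------------------------- conclusion
  have hWT : W = transcript x [] D.gates :=
    eq_transcript_of_gate_equations D x W (by rw [hWlen, hDlen]) hgate
  rw [eval_eq_wireVal, ← hWT, hDo, wireVal, hWf, hfin]
  refine congrArg op (funext fun k => ?_)
  by_cases hk : (k : ℕ) < N
  · rw [dif_pos hk, dif_pos hk, eval_eq_wireVal]
  · rw [dif_neg hk, dif_neg hk]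

end Eval

end Materialise

open Materialise HeaderHardwiring in
/-- **Registered stub `stub_monadicGuess`** (crux stmt-PneNP-2145): one monadic guess over `Fin g`
is affordable at the cost of a factor `2^g` — for a `tcBasis`-circuit `C` on matrix-plus-point
inputs, symmetric over `(σ × σ) ⊕ σ` for every `σ ∈ Sym(Fin g)`, some square-symmetric
`tcBasis`-circuit with exactly `2^g · |C| + 3` gates computes `x ↦ [∃ S ⊆ Fin g, C(x, 1_S)]`.
Construction: `Materialise.exists_layout` with `2^g` blocks (subsets enumerated by
`Fin (2^g) ≃ Finset (Fin g)`), prefix `[∧₀, ∨₀]`, final gate `∨`; symmetry by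
`Materialise.layout_isInducedAut` (blocks permuted by `S ↦ σ(S)`), value by `Materialise.eval_layout`. -/
theorem stub_monadicGuess : ∀ (g : ℕ) (C : Circuit ((Fin g × Fin g) ⊕ Fin g)), C.IsOver tcBasis →
    (∀ σ : Equiv.Perm (Fin g), ∃ τ : Equiv.Perm (Fin C.gates.length),
      C.IsInducedAut (Sum.map (fun p : Fin g × Fin g => (σ p.1, σ p.2)) σ) τ) →
    ∃ D : Circuit (Fin g × Fin g), D.IsOver tcBasis ∧ D.size = 2 ^ g * C.size + 3 ∧
      D.IsSymmetricUnder Set.univ ∧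
      ∀ x : Fin g × Fin g → Bool,
        D.eval x = decide (∃ S : Finset (Fin g), C.eval (Sum.elim x fun u => decide (u ∈ S)) = true) := by
  intro g C hC hsym
  set N := 2 ^ g with hN
  have hcard : Fintype.card (Finset (Fin g)) = N := by simp [hN, Fintype.card_finset]
  set e : Fin N ≃ Finset (Fin g) := (Fintype.equivFinOfCardEq hcard).symm with he
  obtain ⟨pre, hpreL, hpre0, hpreB, hpreV, hpreWF⟩ := exists_constPre (Fin g × Fin g)
  obtain ⟨φ, hφ, hφ_inl, hφ_inr⟩ :=
    Materialise.exists_subsetWire (ι := Fin g × Fin g) N (fun i => e i)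
  set op : (Fin (N + 0) → Bool) → Bool := fun v => decide (∃ k, v k = true) with hop
  set κ : ℕ → ℕ := fun _ => 0 with hκdef
  have hκ : ∀ i, κ i < 2 := fun i => by rw [hκdef]; norm_num
  obtain ⟨D, hDg, hDo⟩ :=
    Materialise.exists_layout N 0 C pre hpreL hpreWF φ hφ op κ hκ
  refine ⟨D, ?_, ?_, ?_, ?_⟩
  · ---------------------------------------------------------------- basis
    intro q hq
    rw [hDg, List.mem_append, List.mem_append, List.mem_ofFn, List.mem_singleton] at hq
    rcases hq with (hq | ⟨v, rfl⟩) | rfl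
    · exact hpreB q hq
    · rw [reloc_fn]
      exact hC _ (List.getElem_mem _)
    · exact acBasis_subset_tcBasis (or_mem_acBasis (N + 0))
  · ---------------------------------------------------------------- size
    change D.gates.length = 2 ^ g * C.gates.length + 3
    rw [layout_length hDg hpreL, ← hN]
    ring
  · ---------------------------------------------------------------- symmetry
    intro ρ _
    obtain ⟨τC, hτC⟩ := hsym ρ
    set π : Equiv.Perm (Fin N) := (e.trans (Equiv.finsetCongr ρ)).trans e.symm with hπ
    have hπe : ∀ (i : Fin N) (u : Fin g), ρ u ∈ e (π i) ↔ u ∈ e i := by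
      intro i u
      rw [hπ, Equiv.trans_apply, Equiv.trans_apply, Equiv.apply_symm_apply,
        Equiv.finsetCongr_apply, Finset.mem_map_equiv, Equiv.symm_apply_apply]
    exact layout_isInducedAut (act := fun (σ : Equiv.Perm (Fin g)) (p : Fin g × Fin g) => (σ p.1, σ p.2))
      hDg hDo hpreL hpre0 hκ hφ_inl hφ_inr ρ π hπe τC hτC
  · ---------------------------------------------------------------- value
    intro x
    rw [eval_layout hDg hDo hpreL hpre0 hpreWF hφ hκ x, hop]
    -- the block assignments are the indicator assignments
    have hX : ∀ (i : Fin N), (fun w => wireOf x (vals pre x) (φ i w)) =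
        Sum.elim x (fun u => decide (u ∈ e i)) := by
      intro i
      funext w
      cases w with
      | inl p => rw [hφ_inl]; rfl
      | inr u =>
        rw [hφ_inr, wireOf_inr, hpreV x, Sum.elim_inr]
        by_cases hu : u ∈ e i
        · rw [if_pos hu, decide_eq_true hu]; rfl
        · rw [if_neg hu, decide_eq_false hu]; rfl
    apply decide_eq_decide.2
    constructor
    · rintro ⟨k, hk⟩
      have hkN : (k : ℕ) < N := by have := k.2; omega
      dsimp only at hk
      rw [dif_pos hkN, hX] at hk
      exact ⟨e ⟨k, hkN⟩, hk⟩
    · rintro ⟨S, hS⟩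
      refine ⟨⟨e.symm S, by have := (e.symm S).2; omega⟩, ?_⟩
      have hkN : ((e.symm S : Fin N) : ℕ) < N := (e.symm S).2
      dsimp only
      rw [dif_pos hkN, hX]
      have : (⟨((e.symm S : Fin N) : ℕ), hkN⟩ : Fin N) = e.symm S := Fin.ext rfl
      rw [this, Equiv.apply_symm_apply]
      exact hS

end Summit.PneNP.PneNP.Theorems
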